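import Summits.BirchSwinnertonDyer.Rank1Residual.Additive.CyclotomicThreeDescentData
import HarnessLib

/-!
# X3 at `p = 3` over `K = ℚ(ζ₃)`: `ord₃ #Ш(V) + ord₃ #Ш(W) ≤ ord₃ #Ш_an(V) + ord₃ #Ш_an(W)` for the
# additive twist `W ≅ V^{(−3)}` of a good ordinary `V`, WITHOUT the descent joint [C] (line V14)

HONEST FRAMING (cell `b2b-bsdres`, run/shared/lean/b2b/bsd-rank1-residual/, verbatim in every
file): the goal of the cell is to DELETE the COMBINATION-SHAPED residual classes of the
Birch–Swinnerton-Dyer formula for ALL analytic-rank `≤ 1` elliptic curves over `ℚ` — "full BSD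
formula for every rank `≤ 1` curve in class `C`" assembled STRICTLY from published theorems — so
that the rank-`≤ 1` remainder becomes exactly the CONSTRUCTION-SHAPED classes, which are TYPED
(missing-input `Prop`s), NOT attempted. This is not "finishing BSD". Seat additive-p4 (research route
on X3/X4); the labels of X3 and X1 are UNCHANGED by this file; nothing is booked here.

Theorems only (no `def`, no `sorry`, no new named fact). Lines V9/V9b close the `p`-part of BSD on the
X3 pairs `(W, p)`, `W ≅ V^{(p*)}` with `V` semistable at `p`, MODULO the typed input [B∘C](0) =
Wuthrich's Thm. 16 for `V` over `ℚ(μ_{p^∞})` ∘ the unprinted descent `X(W/ℚ_∞) ≅ X(V/ℚ(μ_{p^∞}))^{(χ)}`.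
**At `p = 3` no descent is needed**: `ℚ(μ_{3^∞})` is the cyclotomic `ℤ₃`-extension `K_∞` of
`K = ℚ(ζ₃) = ℚ(√−3)`, Wuthrich's `X(V)` is the tree's `SelmerDualData` of the `K`-model `V ⊗ K`, and
Thm. 16 read in `Λ(Γ) ⊂ Λ(G)` gives `char_Λ X(V/K_∞) ∋ u·ϖϖ'·L₃(V,ω⁰,T)·L₃(V,ω¹,T)` (named fact
`Wuthrich2014.charIdeal_dvd_padicLFunction_cyclotomicThree`, here INLINE as `hW16K` in that exact
shape). Over the number field `K`: Greenberg LNM 1716 Thm. 4.1 for `V_K` (inline `hGrK`, the `K`-shape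
of the tree's `hGr`; one prime `𝔭 = (√−3)` over `3`, `k_𝔭 = 𝔽₃`); interpolation at `T = 0`
(`L₃(V,ω⁰,0) = (1−α⁻¹)²[0]⁺_f` PROVED in the tree; `L₃(V,ω¹,0) = α⁻¹∑(a/3)[a/3]⁻_f` inline `hD1`,
MTT §I.14 with the minus symbol); the anomalous factor `(1−α⁻¹)² ∼ #Ẽ(𝔽₃)²` CANCELS (one prime above
`3`, both sides squared — the X1-type anomaly of `(V,3)` is harmless here); even/odd Birch and Pal
(PROVED: `ϖ[0]⁺_f = L(V,1)/Ω_V`, `ϖ'S⁻ = ±L(W,1)|u_C|c_∞/Ω_W`); and Milne 1972 in Dokchitser–Dokchitser's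
model-free form on `V ⊗ K` (`hMilne`) read as an identity of rationals with `ord₃ C(V⊗K) = ord₃∏c(V_K)`
(file `CyclotomicThreeDescentData`). Sum: **`ord₃#Ш(V) + ord₃#Ш(W) ≤ ord₃#Ш_an(V) + ord₃#Ш_an(W)`**.

Assumed (explicit hypotheses, nothing asserted): published — `hW16K`, `hGrK`, `hMilne`, `hGZK`,
`hmod`; routine and dischargeable — `hexK` (the cyclotomic `ℤ₃`-extension of `K` with a generator
`γ ∈ Γ_K`, `χ₃(γ) = 4`: Washington §13.1, the `K`-twin of the tree's PROVED
`exists_isCyclotomic_isTopGenerator_isCyclotomicVariable`), `hD1`. NOT assumed: any typed input of the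
cell, any Selmer descent, any Tamagawa/image bit of `W`. Corollaries and census:
`X3RankZeroCyclotomicThreeUnitRows.lean` (79 CORE-open rank-(0,0) X3 pairs at `p = 3`, 78 doubly-unit).
-/

noncomputable section

open scoped Classical MatrixGroups ModularForm

open CongruenceSubgroup WeierstrassCurve NumberField IsDedekindDomain
  Literature.NumberTheory.EllipticCurves Literature.NumberTheory.EllipticCurves.ModularForms
  Literature.NumberTheory.EllipticCurves.Rank1Residual
  Literature.NumberTheory.EllipticCurves.Rank1Residual.Typed
  Literature.NumberTheory.GaloisRepresentations

namespace Summit.BirchSwinnertonDyer.Rank1Residual.Additive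

/-! ## §3 The core theorem: `ord₃ #Ш(V) + ord₃ #Ш(W) ≤ ord₃ #Ш_an(V) + ord₃ #Ш_an(W)` -/

section Core

variable (K : Type) [Field K] [NumberField K] [IsCyclotomicExtension {3} ℚ K]
  (V : WeierstrassCurve ℚ) [V.IsElliptic] [V.IsGloballyMinimal]
  (W : WeierstrassCurve ℚ) [W.IsElliptic] [W.IsGloballyMinimal]

/-- **Core theorem (line V14, `p = 3`, rank `0 + 0`).** Let `V/ℚ` be globally minimal, good ORDINARY at
`3`, and `W = C • V^{(−3)}` a globally minimal model of its twist by `−3 = d_K`, `K = ℚ(ζ₃)`, with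
`W` ADDITIVE at `3` (the X3 / X4 situation: `W` has Kodaira type `I₀*` at `3`), both of analytic rank
`0`; `f` the newform of `V`, `ϖ·Ω_V = Ω⁺_f`, `ϖ'·|Ω⁻(V)| = Ω⁻_f`. ASSUME, over `K`:
* `hexK` — the cyclotomic `ℤ₃`-extension `K_∞ = ℚ(ζ_{3^∞})` of `K` with a topological generator
  `γ ∈ Γ_K`, `χ₃(γ) = 4` (folklore Galois theory; inline);
* `hW16K` — **Wuthrich 2014 Thm. 16 read over `K`** (the named fact
  `Wuthrich2014.charIdeal_dvd_padicLFunction_cyclotomicThree` specialised to `V`, `K`, `V ⊗ K`):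
  `X(V/K_∞)` is `Λ`-torsion and `u ϖϖ'·L₃(V,ω⁰,T)·L₃(V,ω¹,T) = ι g`, `g ∈ char_Λ X(V/K_∞)`;
* `hGrK` — **Greenberg, LNM 1716, Thm. 4.1 for `E = V_K` over `F = K`** (inline, the `K`-shape of
  the tree's hypothesis `hGr` of `Wuthrich2014.le_padicValRat_of_charIdeal_dvd_padicLFunction`):
  `V_K` has good ordinary reduction at the unique prime `𝔭 = (√−3)` of `K` above `3`
  (`k_𝔭 = 𝔽₃`, `Ẽ_𝔭 = V mod 3`), so if `Sel_{3^∞}(V_K/K)` is finite and `f_E` generates `char_Λ X(V/K_∞)`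
  then `f_E(0)·#V(K)[3^∞]² ∼ 3^{ord₃ ∏_w c_w(V_K)} · #Ẽ(𝔽₃)[3^∞]² · #Sel_{3^∞}(V_K/K)`;
* `hD1` — the constant term of the ODD branch: `L₃(V,ω¹,0) = α⁻¹ ∑_{a mod 3} (a/3)[a/3]⁻_f`
  (Mazur–Tate–Teitelbaum 1986 §I.14 with the minus symbol; inline, dischargeable from the distribution
  law of `μ⁻_{f,α}` exactly as the even twin `constantCoeff_padicLFunctionBranch_half`).
THEN, with Milne 1972 in Dokchitser–Dokchitser's model-free form (`hMilne`, Literature fact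
`Milne1972.bsdQuotient_baseChange_quadratic_anyModel`), Gross–Zagier–Kolyvagin (`hGZK`) and modularity
(`hmod`): `#Ш_an(V) = q_V`, `#Ш_an(W) = q_W` are rationals with
**`ord₃ #Ш(V) + ord₃ #Ш(W) ≤ ord₃ q_V + ord₃ q_W`**.

Proof: module docstring (interpolation + Euler characteristic over `K` + Milne read in `ℚ`).
[cite: Wuthrich2014, Thm. 16 (p. 397)] [cite: GreenbergLNM1716, Thm. 4.1 (p. 102)]
[cite: MazurTateTeitelbaum1986Invent, §I.14] [cite: Milne1972ArithmeticAV, §1 Thm. 1] -/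
theorem X3CyclotomicThree.exists_padicVal_shaOrder_add_le
    (hGZK : rank_eq_analyticRank_of_analyticRank_le_one) (hmod : hasEntireLFunction_rat)
    (hMilne : Milne1972.bsdQuotient_baseChange_quadratic_anyModel)
    (C : VariableChange ℚ) (hC : C • V.quadraticTwist (-(3 : ℚ)) = W)
    (hord : IsOrdinaryAt V 3) (hadd : Addv W 3)
    (hrV : V.analyticRank = 0) (hrW : W.analyticRank = 0)
    {N : ℕ} [NeZero N] {f : CuspForm (Gamma0 N) 2} (hf : IsNewformOf V f)
    (ϖ ϖ' : ℚ) (hϖ : (ϖ : ℝ) * V.realPeriodRat = plusPeriod f)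
    (hϖ' : (ϖ' : ℝ) * V.imaginaryPeriodRat = minusPeriod f)
    (hexK : ∃ κ : ZpExtension K 3, κ.IsCyclotomic ∧ ∃ γ : Field.absoluteGaloisGroup K,
      κ.IsTopGenerator γ ∧ ∃ ζ : ℤ_[3]ˣ, IsOfFinOrder ζ ∧
        ((GaloisRep.cyclotomicCharacter K 3 γ * ζ : ℤ_[3]ˣ) : ℤ_[3]) = (cyclotomicGenerator 3 : ℤ_[3]))
    (hW16K : ∀ (κ : ZpExtension K 3) (γ : Field.absoluteGaloisGroup K),
      κ.IsCyclotomic → κ.IsTopGenerator γ →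
      (∃ ζ : ℤ_[3]ˣ, IsOfFinOrder ζ ∧
        ((GaloisRep.cyclotomicCharacter K 3 γ * ζ : ℤ_[3]ˣ) : ℤ_[3]) = (cyclotomicGenerator 3 : ℤ_[3])) →
      ∀ D : (V.baseChange K).SelmerDualData κ γ,
        D.IsTorsion ∧ ∃ g ∈ D.charIdeal, ∃ u : ℤ_[3]ˣ,
          iwasawaToPowerSeries 3 g =
            PowerSeries.C (((u : ℤ_[3]) : ℚ_[3]) * (ϖ : ℚ_[3]) * (ϖ' : ℚ_[3])) *
              (padicLFunction f ((unitRoot V 3 : ℤ_[3]) : ℚ_[3]) *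
                padicLFunctionMinusBranch f ((unitRoot V 3 : ℤ_[3]) : ℚ_[3]) 1))
    (hGrK : ∀ (κ : ZpExtension K 3) (γ : Field.absoluteGaloisGroup K),
        κ.IsCyclotomic → κ.IsTopGenerator γ →
      ∀ (D : (V.baseChange K).SelmerDualData κ γ) [Module.Finite (IwasawaAlgebra 3) D.X], D.IsTorsion →
      ∀ (fE : IwasawaAlgebra 3), D.charIdeal = Ideal.span {fE} →
        Finite ((V.baseChange K).selmerGroupPInfty 3) →
        ∃ u : ℤ_[3]ˣ,
          ((PowerSeries.constantCoeff fE : ℤ_[3]) : ℚ_[3]) *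
              (Nat.card (AddCommGroup.primaryComponent (V.baseChange K).toAffine.Point 3) : ℚ_[3]) ^ 2 =
            ((u : ℤ_[3]) : ℚ_[3]) * (3 : ℚ_[3]) ^ (padicValNat 3 (V.baseChange K).tamagawaProduct) *
              (Nat.card (AddCommGroup.primaryComponent
                ((integralModelInt V).map (Int.castRingHom (ZMod 3))).toAffine.Point 3) : ℚ_[3]) ^ 2 *
              (Nat.card ((V.baseChange K).selmerGroupPInfty 3) : ℚ_[3]))
    (hD1 : PowerSeries.constantCoeff (padicLFunctionMinusBranch f ((unitRoot V 3 : ℤ_[3]) : ℚ_[3]) 1) =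
      (((unitRoot V 3 : ℤ_[3]) : ℚ_[3]))⁻¹ * (legendreMinusSymbolSum f 3 : ℚ_[3])) :
    ∃ qV qW : ℚ, shaAn V = (qV : ℂ) ∧ shaAn W = (qW : ℂ) ∧
      (padicValNat 3 V.shaOrder : ℤ) + padicValNat 3 W.shaOrder ≤ padicValRat 3 qV + padicValRat 3 qW := by
  classical
  set p : ℕ := 3 with hp3
  -- §0 facts about `K`
  have h2 : Module.finrank ℚ K = 2 := finrank_eq_two_of_isCyclotomicExtension_three (K := K)
  have hdK : (NumberField.discr K : ℚ) = -(3 : ℚ) := by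
    rw [discr_cyclotomicThree K]; norm_num
  haveI : IsTotallyComplex K := isTotallyComplex_cyclotomicThree K
  have hC' : C • V.quadraticTwist (NumberField.discr K : ℚ) = W := by rw [hdK]; exact hC
  -- rank 0: `L(·,1) ≠ 0`, Mordell–Weil groups and `Ш` finite
  have hLV : V.entireLFunction 1 ≠ 0 := (V.analyticRank_eq_zero_iff_holds (hmod V)).mp hrV
  have hLW : W.entireLFunction 1 ≠ 0 := (W.analyticRank_eq_zero_iff_holds (hmod W)).mp hrW
  obtain ⟨hmwV, hfinV⟩ := hGZK V (by rw [hrV]; exact zero_le_one)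
  obtain ⟨hmwW, hfinW⟩ := hGZK W (by rw [hrW]; exact zero_le_one)
  haveI : Finite V.sha := hfinV
  haveI : Finite W.sha := hfinW
  haveI hEV : Finite V.toAffine.Point := V.finite_point_of_rank_zero (by rw [hmwV, hrV])
  haveI hEW : Finite W.toAffine.Point := W.finite_point_of_rank_zero (by rw [hmwW, hrW])
  -- the canonical `K`-model `V ⊗ K`: finiteness and Milne's identity
  set VK := V.baseChange K with hVK
  haveI hEK : Finite VK.toAffine.Point := finite_point_baseChange_of_twist K V W h2 hC'
  obtain ⟨hshaK, hWR⟩ := hMilne V K h2 W ⟨C, hC'⟩ VK ⟨1, one_smul _ _⟩ hfinV hfinW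
  haveI : Finite VK.sha := hshaK
  haveI : Finite (AddCommGroup.primaryComponent VK.sha p) :=
    Finite.of_injective _ Subtype.val_injective
  have hSelfin : Finite (VK.selmerGroupPInfty p) :=
    (VK.finite_selmerGroupPInfty_iff p).mpr ⟨hEK, inferInstance⟩
  have hcard := card_identity_baseChange K V W h2 hC' hWR
  -- the cyclotomic setting over `K`, the Iwasawa module `X(V/K_∞)`
  obtain ⟨κ, hκ, γ, hγ, hγ'⟩ := hexK
  obtain ⟨D⟩ := VK.nonempty_selmerDualData_holds κ γ hγ
  haveI : Module.Finite (IwasawaAlgebra p) D.X :=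
    (SelmerDualData.module_finite_of_isCyclotomic (W := VK) (κ := κ) hκ D) hγ
  -- [B₃] Wuthrich over `K`
  obtain ⟨hX, g, hgmem, u, hιg⟩ := hW16K κ γ hκ hγ hγ' D
  haveI : (Module.charIdeal (IwasawaAlgebra p) D.X).IsPrincipal := charIdeal_isPrincipal_holds p D.X
  obtain ⟨fE, hchar⟩ := Submodule.IsPrincipal.principal (Module.charIdeal (IwasawaAlgebra p) D.X)
  have hchar' : D.charIdeal = Ideal.span {fE} := hchar
  have hgmem' : g ∈ Ideal.span {fE} := by rw [← hchar']; exact hgmem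
  obtain ⟨h, hgh⟩ := Ideal.mem_span_singleton'.mp hgmem'
  -- [A₃] Greenberg over `K`
  obtain ⟨u₁, hu₁⟩ := hGrK κ γ hκ hγ D hX fE hchar' hSelfin
  -- the analytic side over `ℚ` for `V`: `t_V = ϖ [0]⁺_f = L(V,1)/Ω_V`
  set sV : ℚ := ratPlusSymbol f 0 with hsV
  set tV : ℚ := ϖ * sV with htV
  have hΩV : (V.realPeriodRat : ℂ) ≠ 0 := by exact_mod_cast V.realPeriodRat_pos_holds.ne'
  have hLvalV : V.entireLFunction 1 = (((sV : ℝ) * plusPeriod f : ℝ) : ℂ) := hf.entireLFunction_one_eq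
  have hqV' : V.entireLFunction 1 / (V.realPeriodRat : ℂ) = ((tV : ℚ) : ℂ) := by
    rw [hLvalV, ← hϖ, div_eq_iff hΩV, htV]
    push_cast
    ring
  have htV0 : tV ≠ 0 := by
    intro h0
    apply hLV
    have := (div_eq_iff hΩV).mp hqV'
    rw [this, h0]
    simp
  obtain ⟨-, -, -, hshaV⟩ := Wuthrich2014.shaAn_eq_of_L_one_div_eq hGZK V hLV hqV'
  -- the analytic side over `ℚ` for `W`: odd Birch + Pal
  obtain ⟨ε, hε, hLW_eq⟩ :=
    entireLFunction_one_eq_of_twist_neg 3 hmod (by norm_num) V W C hC hadd hf ϖ' hϖ'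
  set S : ℚ := legendreMinusSymbolSum f 3 with hS
  set cinf : ℕ := (W.baseChange ℝ).numRealComponents with hcinf
  set tW : ℚ := ε * (ϖ' * S) / (|(C.u : ℚ)| * (cinf : ℚ)) with htW
  have hΩW : (W.realPeriodRat : ℂ) ≠ 0 := by exact_mod_cast W.realPeriodRat_pos_holds.ne'
  have hqW' : W.entireLFunction 1 / (W.realPeriodRat : ℂ) = (tW : ℂ) := by
    rw [hLW_eq, mul_div_cancel_right₀ _ hΩW]
  obtain ⟨-, -, -, hshaW⟩ := Wuthrich2014.shaAn_eq_of_L_one_div_eq hGZK W hLW hqW'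
  have hua0 : |(C.u : ℚ)| ≠ 0 := abs_ne_zero.mpr C.u.ne_zero
  have hcinf0 : (cinf : ℚ) ≠ 0 := by
    rw [hcinf, numRealComponents]
    split_ifs <;> norm_num
  have hden0 : |(C.u : ℚ)| * (cinf : ℚ) ≠ 0 := mul_ne_zero hua0 hcinf0
  have hϖS : ϖ' * S ≠ 0 := by
    intro h0
    apply hLW
    rw [hLW_eq, htW, h0, mul_zero, zero_div, Rat.cast_zero, zero_mul]
  have hε0 : ε ≠ 0 := by rcases hε with h | h <;> rw [h] <;> norm_num
  have htW0 : tW ≠ 0 := by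
    rw [htW]
    exact div_ne_zero (mul_ne_zero hε0 hϖS) hden0
  have hvε : padicValRat 3 ε = 0 := by
    rcases hε with h | h
    · rw [h, padicValRat.one]
    · rw [h, padicValRat.neg, padicValRat.one]
  have hvtW : padicValRat 3 tW = padicValRat 3 (ϖ' * S) - padicValRat 3 |(C.u : ℚ)| := by
    rw [htW, padicValRat.div (mul_ne_zero hε0 hϖS) hden0, padicValRat.mul hε0 hϖS,
      padicValRat.mul hua0 hcinf0, hvε, padicValRat_numRealComponents_eq_zero W 3 (by norm_num)]
    ring
  -- the unit root and the constant term `g(0)`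
  set a : ℚ_[3] := ((unitRoot V 3 : ℤ_[3]) : ℚ_[3]) with ha
  obtain ⟨-, hunit⟩ := unitRoot_spec_holds V 3 hord
  obtain ⟨ua, hua⟩ := hunit
  have haU : a = ((ua : ℤ_[3]) : ℚ_[3]) := by rw [ha, hua]
  have ha0 : a ≠ 0 := by rw [haU]; exact coe_units_ne_zero 3 ua
  have hL0 : PowerSeries.constantCoeff (padicLFunction f a) = (1 - a⁻¹) ^ 2 * (sV : ℚ_[3]) := by
    rw [ha]
    exact constantCoeff_padicLFunction_unitRoot hord hf
  have hg0 : ((PowerSeries.constantCoeff g : ℤ_[3]) : ℚ_[3]) =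
      ((u : ℤ_[3]) : ℚ_[3]) * a⁻¹ * (1 - a⁻¹) ^ 2 * ((tV : ℚ) : ℚ_[3]) * ((ϖ' * S : ℚ) : ℚ_[3]) := by
    rw [← constantCoeff_iwasawaToPowerSeries 3 g, hιg]
    simp only [map_mul, PowerSeries.constantCoeff_C, hL0, hD1, htV]
    push_cast
    ring
  -- `g(0) = h(0) · fE(0)`
  have hg0' : (PowerSeries.constantCoeff g : ℤ_[3]) =
      PowerSeries.constantCoeff h * PowerSeries.constantCoeff fE := by
    rw [← hgh, map_mul]
  -- the anomalous factor: `1 - a⁻¹ = u₂ · #Ẽ(𝔽₃) = u₂ u₃ · #Ẽ(𝔽₃)[3^∞]`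
  obtain ⟨u₂, hu₂⟩ := exists_unit_one_sub_unitRoot_inv 3 V hord
  obtain ⟨u₃, hu₃⟩ := exists_unit_natCard_eq_mul_card_primaryComponent
    ((integralModelInt V).map (Int.castRingHom (ZMod 3))).toAffine.Point 3
  set Np : ℚ_[3] := (Nat.card (AddCommGroup.primaryComponent
    ((integralModelInt V).map (Int.castRingHom (ZMod 3))).toAffine.Point 3) : ℚ_[3]) with hNp
  have hNcount : (V.reductionPointCount 3 : ℚ_[3]) = ((u₃ : ℤ_[3]) : ℚ_[3]) * Np := by
    rw [WeierstrassCurve.reductionPointCount, hNp]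
    exact hu₃
  have hNp0 : Np ≠ 0 := by
    rw [hNp]
    exact_mod_cast Nat.card_pos.ne'
  have h1 : (1 - a⁻¹) = ((u₂ : ℤ_[3]) : ℚ_[3]) * ((u₃ : ℤ_[3]) : ℚ_[3]) * Np := by
    rw [ha, hu₂, hNcount, mul_assoc]
  -- names
  set TK : ℚ_[3] := (Nat.card (AddCommGroup.primaryComponent VK.toAffine.Point 3) : ℚ_[3]) with hTK
  set ShK : ℚ_[3] := (Nat.card (AddCommGroup.primaryComponent VK.sha 3) : ℚ_[3]) with hShK
  set h0 : ℚ_[3] := ((PowerSeries.constantCoeff h : ℤ_[3]) : ℚ_[3]) with hh0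
  set vK : ℕ := padicValNat 3 VK.tamagawaProduct with hvK
  have hSelK : (Nat.card (VK.selmerGroupPInfty 3) : ℚ_[3]) = ShK := by
    rw [hShK, VK.natCard_selmerGroupPInfty_eq_natCard_primaryComponent_sha 3]
  have hTK0 : TK ≠ 0 := by rw [hTK]; exact_mod_cast Nat.card_pos.ne'
  have hShK0 : ShK ≠ 0 := by rw [hShK]; exact_mod_cast Nat.card_pos.ne'
  have hp0 : (3 : ℚ_[3]) ≠ 0 := by exact_mod_cast (by norm_num : (3 : ℕ) ≠ 0)
  have hh0val : 0 ≤ h0.valuation := by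
    rw [hh0]
    exact PadicInt.valuation_coe_nonneg
  have htVQ : ((tV : ℚ) : ℚ_[3]) ≠ 0 := by exact_mod_cast htV0
  have hϖSQ : ((ϖ' * S : ℚ) : ℚ_[3]) ≠ 0 := by exact_mod_cast hϖS
  have hU : ((u : ℤ_[3]) : ℚ_[3]) * a⁻¹ * (((u₂ : ℤ_[3]) : ℚ_[3]) * ((u₃ : ℤ_[3]) : ℚ_[3])) ^ 2 ≠ 0 :=
    mul_ne_zero (mul_ne_zero (coe_units_ne_zero 3 u) (inv_ne_zero ha0))
      (pow_ne_zero 2 (mul_ne_zero (coe_units_ne_zero 3 u₂) (coe_units_ne_zero 3 u₃)))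
  have hUU0 : ((u : ℤ_[3]) : ℚ_[3]) * (((u₂ : ℤ_[3]) : ℚ_[3]) * ((u₃ : ℤ_[3]) : ℚ_[3])) ^ 2 ≠ 0 :=
    mul_ne_zero (coe_units_ne_zero 3 u)
      (pow_ne_zero 2 (mul_ne_zero (coe_units_ne_zero 3 u₂) (coe_units_ne_zero 3 u₃)))
  have hg0ne : PowerSeries.constantCoeff g ≠ 0 := by
    intro h0'
    have h' : ((u : ℤ_[3]) : ℚ_[3]) * a⁻¹ * (1 - a⁻¹) ^ 2 * ((tV : ℚ) : ℚ_[3]) *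
        ((ϖ' * S : ℚ) : ℚ_[3]) = 0 := by rw [← hg0, h0', PadicInt.coe_zero]
    rw [h1] at h'
    have hne : ((u : ℤ_[3]) : ℚ_[3]) * a⁻¹ * (((u₂ : ℤ_[3]) : ℚ_[3]) * ((u₃ : ℤ_[3]) : ℚ_[3]) * Np) ^ 2 *
        ((tV : ℚ) : ℚ_[3]) * ((ϖ' * S : ℚ) : ℚ_[3]) ≠ 0 :=
      mul_ne_zero (mul_ne_zero (mul_ne_zero (mul_ne_zero (coe_units_ne_zero 3 u) (inv_ne_zero ha0))
        (pow_ne_zero 2 (mul_ne_zero (mul_ne_zero (coe_units_ne_zero 3 u₂) (coe_units_ne_zero 3 u₃))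
          hNp0))) htVQ) hϖSQ
    exact hne h'
  have hh0ne : h0 ≠ 0 := by
    rw [hh0]
    intro h0'
    apply hg0ne
    rw [hg0', (PadicInt.coe_eq_zero.mp h0'), zero_mul]
  -- KEY identity in `ℚ₃` (multiplied through by `α`):
  -- `(t_V · (ϖ'S) · T_K²) · (u (u₂u₃)²) = h(0) · ((α u₁) · (3^{v_K} · #Ш(V_K)[3^∞]))`
  have key : (((tV : ℚ) : ℚ_[3]) * ((ϖ' * S : ℚ) : ℚ_[3]) * TK ^ 2) *
        (((u : ℤ_[3]) : ℚ_[3]) * (((u₂ : ℤ_[3]) : ℚ_[3]) * ((u₃ : ℤ_[3]) : ℚ_[3])) ^ 2) =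
      h0 * ((a * ((u₁ : ℤ_[3]) : ℚ_[3])) * ((3 : ℚ_[3]) ^ vK * ShK)) := by
    apply mul_right_cancel₀ (pow_ne_zero 2 hNp0)
    have hg0Q : ((PowerSeries.constantCoeff g : ℤ_[3]) : ℚ_[3]) =
        h0 * ((PowerSeries.constantCoeff fE : ℤ_[3]) : ℚ_[3]) := by
      rw [hg0', hh0]; push_cast; ring
    have e1 : (((tV : ℚ) : ℚ_[3]) * ((ϖ' * S : ℚ) : ℚ_[3]) * TK ^ 2) *
          (((u : ℤ_[3]) : ℚ_[3]) * (((u₂ : ℤ_[3]) : ℚ_[3]) * ((u₃ : ℤ_[3]) : ℚ_[3])) ^ 2) * Np ^ 2 =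
        a * (((u : ℤ_[3]) : ℚ_[3]) * a⁻¹ * (1 - a⁻¹) ^ 2 * ((tV : ℚ) : ℚ_[3]) *
          ((ϖ' * S : ℚ) : ℚ_[3])) * TK ^ 2 := by
      rw [h1]
      field_simp
    calc (((tV : ℚ) : ℚ_[3]) * ((ϖ' * S : ℚ) : ℚ_[3]) * TK ^ 2) *
          (((u : ℤ_[3]) : ℚ_[3]) * (((u₂ : ℤ_[3]) : ℚ_[3]) * ((u₃ : ℤ_[3]) : ℚ_[3])) ^ 2) * Np ^ 2
        = a * (((u : ℤ_[3]) : ℚ_[3]) * a⁻¹ * (1 - a⁻¹) ^ 2 * ((tV : ℚ) : ℚ_[3]) *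
          ((ϖ' * S : ℚ) : ℚ_[3])) * TK ^ 2 := e1
      _ = a * (h0 * ((PowerSeries.constantCoeff fE : ℤ_[3]) : ℚ_[3])) * TK ^ 2 := by rw [← hg0, hg0Q]
      _ = a * h0 * (((PowerSeries.constantCoeff fE : ℤ_[3]) : ℚ_[3]) * TK ^ 2) := by ring
      _ = a * h0 * (((u₁ : ℤ_[3]) : ℚ_[3]) * (3 : ℚ_[3]) ^ vK * Np ^ 2 *
            (Nat.card (VK.selmerGroupPInfty 3) : ℚ_[3])) := by rw [hu₁]
      _ = h0 * ((a * ((u₁ : ℤ_[3]) : ℚ_[3])) * ((3 : ℚ_[3]) ^ vK * ShK)) * Np ^ 2 := by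
          rw [hSelK]; ring
  -- valuations of `key`
  have hva : a.valuation = 0 := by rw [haU]; exact valuation_coe_units_eq_zero 3 ua
  have hvUU : (((u : ℤ_[3]) : ℚ_[3]) * (((u₂ : ℤ_[3]) : ℚ_[3]) * ((u₃ : ℤ_[3]) : ℚ_[3])) ^ 2).valuation
      = 0 := by
    rw [Padic.valuation_mul (coe_units_ne_zero 3 u)
      (pow_ne_zero 2 (mul_ne_zero (coe_units_ne_zero 3 u₂) (coe_units_ne_zero 3 u₃))),
      Padic.valuation_pow, Padic.valuation_mul (coe_units_ne_zero 3 u₂) (coe_units_ne_zero 3 u₃),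
      valuation_coe_units_eq_zero, valuation_coe_units_eq_zero, valuation_coe_units_eq_zero]
    ring
  have hau1 : a * ((u₁ : ℤ_[3]) : ℚ_[3]) ≠ 0 := mul_ne_zero ha0 (coe_units_ne_zero 3 u₁)
  have hvau1 : (a * ((u₁ : ℤ_[3]) : ℚ_[3])).valuation = 0 := by
    rw [Padic.valuation_mul ha0 (coe_units_ne_zero 3 u₁), hva, valuation_coe_units_eq_zero, add_zero]
  have h3K : (3 : ℚ_[3]) ^ vK * ShK ≠ 0 := mul_ne_zero (pow_ne_zero _ hp0) hShK0
  have hval := congrArg Padic.valuation key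
  rw [Padic.valuation_mul (mul_ne_zero (mul_ne_zero htVQ hϖSQ) (pow_ne_zero 2 hTK0)) hUU0, hvUU,
    Padic.valuation_mul (mul_ne_zero htVQ hϖSQ) (pow_ne_zero 2 hTK0), Padic.valuation_mul htVQ hϖSQ,
    Padic.valuation_pow, Padic.valuation_ratCast, Padic.valuation_ratCast,
    Padic.valuation_mul hh0ne (mul_ne_zero hau1 h3K), Padic.valuation_mul hau1 h3K, hvau1,
    Padic.valuation_mul (pow_ne_zero _ hp0) hShK0, Padic.valuation_pow] at hval
  have hv3 : (3 : ℚ_[3]).valuation = 1 := by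
    have h := Padic.valuation_p (p := 3)
    exact_mod_cast h
  rw [hv3] at hval
  -- `v(T_K) = ord₃ #V(K)`, `v(Ш_K[3^∞]) = ord₃ #Ш(V_K)`
  have hvTK : TK.valuation = (padicValNat 3 (Nat.card VK.toAffine.Point) : ℤ) := by
    rw [hTK, Padic.valuation_natCast, padicValNat_card_addPrimaryComponent 3]
  have hvShK : ShK.valuation = (padicValNat 3 VK.shaOrder : ℤ) := by
    rw [hShK, Padic.valuation_natCast, padicValNat_card_addPrimaryComponent 3]
    rfl
  rw [hvTK, hvShK] at hval
  -- (I'): `v_K + ord₃ #Ш(V_K) ≤ ord₃ t_V + ord₃ (ϖ'S) + 2 ord₃ #V(K)`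
  have hI : (vK : ℤ) + padicValNat 3 VK.shaOrder ≤
      padicValRat 3 tV + padicValRat 3 (ϖ' * S) + 2 * padicValNat 3 (Nat.card VK.toAffine.Point) := by
    simp only [Nat.cast_ofNat] at hval
    linarith
  -- Milne's identity in valuations
  have hnV0 : ((V.baseChange ℝ).numRealComponents : ℚ) ≠ 0 := by
    rw [numRealComponents]; split_ifs <;> norm_num
  have hSV0 : (V.shaOrder : ℚ) ≠ 0 := by exact_mod_cast (V.shaOrder_pos hfinV).ne'
  have hSW0 : (W.shaOrder : ℚ) ≠ 0 := by exact_mod_cast (W.shaOrder_pos hfinW).ne'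
  have hSK0 : (VK.shaOrder : ℚ) ≠ 0 := by exact_mod_cast (VK.shaOrder_pos hshaK).ne'
  have hcV0 : (V.tamagawaProduct : ℚ) ≠ 0 := by exact_mod_cast V.tamagawaProduct_pos_holds.ne'
  have hcW0 : (W.tamagawaProduct : ℚ) ≠ 0 := by exact_mod_cast W.tamagawaProduct_pos_holds.ne'
  have hNV0 : ((Nat.card V.toAffine.Point : ℕ) : ℚ) ≠ 0 := by exact_mod_cast Nat.card_pos.ne'
  have hNW0 : ((Nat.card W.toAffine.Point : ℕ) : ℚ) ≠ 0 := by exact_mod_cast Nat.card_pos.ne'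
  have hNK0 : ((Nat.card VK.toAffine.Point : ℕ) : ℚ) ≠ 0 := by exact_mod_cast Nat.card_pos.ne'
  have hRHS0 : ((V.baseChange ℝ).numRealComponents : ℚ) * |(C.u : ℚ)| * V.shaOrder * W.shaOrder *
      V.tamagawaProduct * W.tamagawaProduct * ((Nat.card VK.toAffine.Point : ℕ) : ℚ) ^ 2 ≠ 0 :=
    mul_ne_zero (mul_ne_zero (mul_ne_zero (mul_ne_zero (mul_ne_zero (mul_ne_zero hnV0 hua0) hSV0)
      hSW0) hcV0) hcW0) (pow_ne_zero 2 hNK0)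
  have hM0 : VK.modifiedTamagawaProduct ≠ 0 := by
    intro hM
    rw [hVK] at hM
    rw [hM, zero_mul, zero_mul, zero_mul] at hcard
    exact hRHS0 hcard.symm
  have hvM : padicValRat 3 VK.modifiedTamagawaProduct = padicValNat 3 VK.tamagawaProduct :=
    padicValRat_modifiedTamagawaProduct_baseChange V 3
      (fun hdvd ↦ V.not_hasGoodReductionAtPrime_of_dvd_minimalDiscriminantInt 3 hdvd hord.1)
  have hvcard := congrArg (padicValRat 3) hcard
  rw [hVK] at hM0
  rw [padicValRat.mul (mul_ne_zero (mul_ne_zero hM0 hSK0) (pow_ne_zero 2 hNV0)) (pow_ne_zero 2 hNW0),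
    padicValRat.mul (mul_ne_zero hM0 hSK0) (pow_ne_zero 2 hNV0), padicValRat.mul hM0 hSK0,
    padicValRat.pow, padicValRat.pow,
    padicValRat.mul (mul_ne_zero (mul_ne_zero (mul_ne_zero (mul_ne_zero (mul_ne_zero hnV0 hua0) hSV0)
      hSW0) hcV0) hcW0) (pow_ne_zero 2 hNK0),
    padicValRat.mul (mul_ne_zero (mul_ne_zero (mul_ne_zero (mul_ne_zero hnV0 hua0) hSV0) hSW0) hcV0) hcW0,
    padicValRat.mul (mul_ne_zero (mul_ne_zero (mul_ne_zero hnV0 hua0) hSV0) hSW0) hcV0,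
    padicValRat.mul (mul_ne_zero (mul_ne_zero hnV0 hua0) hSV0) hSW0,
    padicValRat.mul (mul_ne_zero hnV0 hua0) hSV0, padicValRat.mul hnV0 hua0, padicValRat.pow,
    padicValRat_numRealComponents_eq_zero V 3 (by norm_num),
    padicValRat.of_nat, padicValRat.of_nat, padicValRat.of_nat, padicValRat.of_nat,
    padicValRat.of_nat, padicValRat.of_nat, padicValRat.of_nat, padicValRat.of_nat] at hvcard
  rw [← hVK] at hvcard
  rw [hvM] at hvcard
  -- conclusion
  refine ⟨tV * (Nat.card V.toAffine.Point : ℚ) ^ 2 / (V.tamagawaProduct : ℚ),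
    tW * (Nat.card W.toAffine.Point : ℚ) ^ 2 / (W.tamagawaProduct : ℚ), hshaV, hshaW, ?_⟩
  rw [padicValRat.div (mul_ne_zero htV0 (pow_ne_zero 2 hNV0)) hcV0,
    padicValRat.mul htV0 (pow_ne_zero 2 hNV0), padicValRat.pow, padicValRat.of_nat, padicValRat.of_nat,
    padicValRat.div (mul_ne_zero htW0 (pow_ne_zero 2 hNW0)) hcW0,
    padicValRat.mul htW0 (pow_ne_zero 2 hNW0), padicValRat.pow, padicValRat.of_nat, padicValRat.of_nat,
    hvtW]
  push_cast at hI hvcard ⊢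
  linarith


end Core

end Summit.BirchSwinnertonDyer.Rank1Residual.Additive

end
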